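import Mathlib
import HarnessLib
import Summits.HubbardSuperconductivity.HubbardSuperconductivity.Theorems.KLProgrammeKLRegimeTwoVolumeMomentumReadout

/-!
# Route `KLProgramme` — crux K3, VL child `KLRegimeVolumeLimitV17F2` (stmt-HubbardSuperconductivity-20440), ROUTE A bracket (A5) FOR THE VL STUB:
# the read-out at a common grid momentum — THE DOOR AT A PIN for the model's grid actions
# (cell gate-hubbard-kl, seat hubbard-kl-k3c5-p3 g9, technique «OS-positivity-free direct assembly»)

Sequel of `…TwoVolumeMomentumReadout`.  `norm_klSelfEnergy_sub_le_resummed_of_latticeMomentum_eq` reads the two-volume, two-frame difference of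
`klSelfEnergy … K … (i,k) σ` at a common lattice momentum from grid representations `W̃c`, `W̃f` of the purely quartic K-resummed theories under
(hrep) `map S W̃ = effAction C̃ V_U`, (hrow) base-point independence of the phase-weighted two-leg rows, (geometry) a block embedding `ι` with base point
at the origin.  Here all three are discharged — exactly as in k3c5-p2's `…TwoVolumeReadoutPin.abs_klLocalPart_sub_le_gridDefect_pin` (centred block
coordinates around the pin, `map_gridSubMatrix_shift_gridEffAction`, `gridEffAction_row_eq_row_shift`) — for THE grid actions
`W̃^{K}_L := effAction (S_Lᵀ·normalCovariance p̃^{K}_L·S_L) (hubbardGridInteraction L N β U)`, `S_L = hubbardGridSub L M β N`, at an ARBITRARY fine pin `w`: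

* **`norm_klSelfEnergy_sub_le_gridDefect_pin`** — for `0 < β`, `Lf = b·Lc`, `2M ≤ N`, `4M ≤ N + 1`, unit framed partition functions, frames
  `Kc`/`Kf`, every scale `n`, label `i`, spin `σ`, fine pin `w`, and momenta `k`, `k″` with `p_{k″} = p_k`:
  `‖Σ^{Kc}_{Lc}(i,k,σ) − Σ^{Kf}_{Lf}(i,k″,σ)‖ ≤ ‖E_{Kc}(p) − E_{Kf}(p)‖ + ‖τ_{Kc}(p) − τ_{Kf}(p)‖·(2N/|β|)·N₂(W̃c; ō) + ‖τ_{Kf}(p)‖·(2N/|β|)·Def_w(W̃c, W̃f)`,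
  `Def_w = Σ_{p₁} ‖W̃c(ō,p₁) − W̃f(w, ι p₁)‖ + Σ_{p₁′ ∉ range ι} ‖W̃f(w,p₁′)‖`, `ō = (time w, c̄)`, `c̄ = (r₀,r₀)`, `r₀ = (Lc−1)/2` — the Grassmann
  side is literally the PINNED TWO-LEG DEFECT of two explicit grid effective actions at one pin (what ROUTE A's (A3) bounds at the deepest pin).

Proofs only; no definition.  References: BGM 2006 §2.4 (2.38); FST 1996 §1.
-/

noncomputable section

namespace Summit.HubbardSuperconductivity.HubbardSuperconductivity.Theorems.TwoVolumeDefect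

set_option linter.dupNamespace false -- summit = problem name (single-conjunct summit), D-0017

open Finset Literature.MathematicalPhysics.QuantumLattice GrassmannAlgebra Literature.Probability.LatticeModels
open Summit.HubbardSuperconductivity.HubbardSuperconductivity.Theorems.KLRegimeSplit
open Summit.HubbardSuperconductivity.HubbardSuperconductivity.Theorems.KLProgrammeLegKernels
open Summit.HubbardSuperconductivity.HubbardSuperconductivity.Theorems.TwoLegFourier
open scoped ComplexConjugate

/-! ## The door at a pin -/

section Door

variable {b Lc Lf M N : ℕ} [NeZero Lc] [NeZero Lf] [NeZero M] [NeZero N]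

/-- **THE VL READ-OUT AT A PIN, TWO FRAMES.**  `0 < β`, nested volumes `Lf = b·Lc`, common Matsubara cutoff `M` and time grid `N` (`2M ≤ N`,
`4M ≤ N + 1`), frames `Kc` (coarse) / `Kf` (fine) with unit framed partition functions, any scale `n`, label `i`, spin `σ`, any fine pin `w`; coarse
momentum `k` and fine momentum `k″` with the same lattice momentum `p`.  With `c̄ = (r₀,r₀)`, `r₀ = (Lc−1)/2`, `ι (j,x̄) = (j, site w + clift(x̄ − c̄))`,
`u_K(q) = uvSymbolFn 1 Λ_n (ε(q) − μ − K(q)) (ω_i)`, the resummed symbols `p̃^{K}_L = p^{K}_L/(1 + p^{K}_L κ^{K}_L)` and THE grid actions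
`W̃^{K}_L = effAction (S_Lᵀ·normalCovariance p̃^{K}_L·S_L) (hubbardGridInteraction L N β U)`:
`‖klSelfEnergy Lc … Kc klE0 n (i,k) σ − klSelfEnergy Lf … Kf klE0 n (i,k″) σ‖ ≤ ‖E_{Kc}(p) − E_{Kf}(p)‖ + ‖τ_{Kc}(p) − τ_{Kf}(p)‖·(2N/|β|)·N₂(W̃c) +
‖τ_{Kf}(p)‖·(2N/|β|)·Def_w(W̃c^{Kc}, W̃f^{Kf})`. [cite: BenfattoGiulianiMastropietro2006, §2.4 (2.38)] -/
theorem norm_klSelfEnergy_sub_le_gridDefect_pin (hL : Lf = b * Lc) {β : ℝ} (hβ : 0 < β) (hN : 2 * M ≤ N) (hN4 : 4 * M ≤ N + 1)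
    (U μ : ℝ) (Kc Kf : TrigPolyC4v) (n : ℕ) (w : GridPoint Lf N) (i : MatsubaraIdx M) (σ : Fin 2)
    (hZc : IsUnit (effPartitionFn ℂ (normalCovariance Lc M (uvSymbolCT Lc M β μ Kc (klScale klE0 n)))
      (hubbardInteraction Lc M β U + counterQuadratic Lc M β Kc)))
    (hZf : IsUnit (effPartitionFn ℂ (normalCovariance Lf M (uvSymbolCT Lf M β μ Kf (klScale klE0 n)))
      (hubbardInteraction Lf M β U + counterQuadratic Lf M β Kf)))
    {k : TorusSite 2 Lc} {k'' : TorusSite 2 Lf} (hk : latticeMomentum Lf k'' = latticeMomentum Lc k) :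
    ‖klSelfEnergy Lc M β U μ Kc klE0 n (i, k) σ - klSelfEnergy Lf M β U μ Kf klE0 n (i, k'') σ‖ ≤
      ‖((Kc.eval (latticeMomentum Lc k) : ℂ) - (Kc.eval (latticeMomentum Lc k) : ℂ) ^ 2 *
            (uvSymbolFn 1 (klScale klE0 n) (-2 * (∑ l : Fin 2, Real.cos (latticeMomentum Lc k l)) - μ - Kc.eval (latticeMomentum Lc k))
                (matsubaraFreq β M i) /
              (1 + uvSymbolFn 1 (klScale klE0 n) (-2 * (∑ l : Fin 2, Real.cos (latticeMomentum Lc k l)) - μ - Kc.eval (latticeMomentum Lc k))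
                (matsubaraFreq β M i) * Kc.eval (latticeMomentum Lc k)))) -
          ((Kf.eval (latticeMomentum Lc k) : ℂ) - (Kf.eval (latticeMomentum Lc k) : ℂ) ^ 2 *
            (uvSymbolFn 1 (klScale klE0 n) (-2 * (∑ l : Fin 2, Real.cos (latticeMomentum Lc k l)) - μ - Kf.eval (latticeMomentum Lc k))
                (matsubaraFreq β M i) /
              (1 + uvSymbolFn 1 (klScale klE0 n) (-2 * (∑ l : Fin 2, Real.cos (latticeMomentum Lc k l)) - μ - Kf.eval (latticeMomentum Lc k))
                (matsubaraFreq β M i) * Kf.eval (latticeMomentum Lc k))))‖ +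
        ‖(1 - (Kc.eval (latticeMomentum Lc k) : ℂ) *
              (uvSymbolFn 1 (klScale klE0 n) (-2 * (∑ l : Fin 2, Real.cos (latticeMomentum Lc k l)) - μ - Kc.eval (latticeMomentum Lc k))
                  (matsubaraFreq β M i) /
                (1 + uvSymbolFn 1 (klScale klE0 n) (-2 * (∑ l : Fin 2, Real.cos (latticeMomentum Lc k l)) - μ - Kc.eval (latticeMomentum Lc k))
                  (matsubaraFreq β M i) * Kc.eval (latticeMomentum Lc k)))) ^ 2 -
            (1 - (Kf.eval (latticeMomentum Lc k) : ℂ) *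
              (uvSymbolFn 1 (klScale klE0 n) (-2 * (∑ l : Fin 2, Real.cos (latticeMomentum Lc k l)) - μ - Kf.eval (latticeMomentum Lc k))
                  (matsubaraFreq β M i) /
                (1 + uvSymbolFn 1 (klScale klE0 n) (-2 * (∑ l : Fin 2, Real.cos (latticeMomentum Lc k l)) - μ - Kf.eval (latticeMomentum Lc k))
                  (matsubaraFreq β M i) * Kf.eval (latticeMomentum Lc k)))) ^ 2‖ *
          (2 * N / |β| * ∑ p₁ : GridPoint Lc N, ‖kernel ℂ (effAction ℂ ((hubbardGridSub Lc M β N).transpose *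
              normalCovariance Lc M (fun ks => uvSymbolCT Lc M β μ Kc (klScale klE0 n) ks /
                (1 + uvSymbolCT Lc M β μ Kc (klScale klE0 n) ks * ((Kc.eval (latticeMomentum Lc ks.1.2) / (β * (Lc : ℝ) ^ 2) : ℝ) : ℂ))) *
              hubbardGridSub Lc M β N) (hubbardGridInteraction Lc N β U)) 2
              (fun j => ((![((w.1, fun _ : Fin 2 => (((Lc - 1) / 2 : ℕ) : ZMod Lc)) : GridPoint Lc N), p₁] j, σ), j))‖) +
        ‖(1 - (Kf.eval (latticeMomentum Lc k) : ℂ) *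
              (uvSymbolFn 1 (klScale klE0 n) (-2 * (∑ l : Fin 2, Real.cos (latticeMomentum Lc k l)) - μ - Kf.eval (latticeMomentum Lc k))
                  (matsubaraFreq β M i) /
                (1 + uvSymbolFn 1 (klScale klE0 n) (-2 * (∑ l : Fin 2, Real.cos (latticeMomentum Lc k l)) - μ - Kf.eval (latticeMomentum Lc k))
                  (matsubaraFreq β M i) * Kf.eval (latticeMomentum Lc k)))) ^ 2‖ *
          (2 * N / |β| *
            ((∑ p₁ : GridPoint Lc N, ‖kernel ℂ (effAction ℂ ((hubbardGridSub Lc M β N).transpose *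
                normalCovariance Lc M (fun ks => uvSymbolCT Lc M β μ Kc (klScale klE0 n) ks /
                  (1 + uvSymbolCT Lc M β μ Kc (klScale klE0 n) ks * ((Kc.eval (latticeMomentum Lc ks.1.2) / (β * (Lc : ℝ) ^ 2) : ℝ) : ℂ))) *
                hubbardGridSub Lc M β N) (hubbardGridInteraction Lc N β U)) 2
                (fun j => ((![((w.1, fun _ : Fin 2 => (((Lc - 1) / 2 : ℕ) : ZMod Lc)) : GridPoint Lc N), p₁] j, σ), j)) -
              kernel ℂ (effAction ℂ ((hubbardGridSub Lf M β N).transpose *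
                normalCovariance Lf M (fun ks => uvSymbolCT Lf M β μ Kf (klScale klE0 n) ks /
                  (1 + uvSymbolCT Lf M β μ Kf (klScale klE0 n) ks * ((Kf.eval (latticeMomentum Lf ks.1.2) / (β * (Lf : ℝ) ^ 2) : ℝ) : ℂ))) *
                hubbardGridSub Lf M β N) (hubbardGridInteraction Lf N β U)) 2
                (fun j => ((![w, ((p₁.1, w.2 + Torus.proj Lf (Torus.cRep (p₁.2 - fun _ : Fin 2 => (((Lc - 1) / 2 : ℕ) : ZMod Lc)))) :
                  GridPoint Lf N)] j, σ), j))‖) +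
            ∑ p₁' ∈ univ.filter (fun p₁' : GridPoint Lf N => p₁' ∉ Set.range (fun p : GridPoint Lc N =>
                ((p.1, w.2 + Torus.proj Lf (Torus.cRep (p.2 - fun _ : Fin 2 => (((Lc - 1) / 2 : ℕ) : ZMod Lc)))) : GridPoint Lf N))),
              ‖kernel ℂ (effAction ℂ ((hubbardGridSub Lf M β N).transpose *
                normalCovariance Lf M (fun ks => uvSymbolCT Lf M β μ Kf (klScale klE0 n) ks /
                  (1 + uvSymbolCT Lf M β μ Kf (klScale klE0 n) ks * ((Kf.eval (latticeMomentum Lf ks.1.2) / (β * (Lf : ℝ) ^ 2) : ℝ) : ℂ))) *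
                hubbardGridSub Lf M β N) (hubbardGridInteraction Lf N β U)) 2 (fun j => ((![w, p₁'] j, σ), j))‖)) := by
  classical
  -- data of the centred coordinates (as in `abs_klLocalPart_sub_le_gridDefect_pin`)
  set cbar : TorusSite 2 Lc := fun _ : Fin 2 => (((Lc - 1) / 2 : ℕ) : ZMod Lc) with hcbar
  set tc : GridPoint Lc N := ((0 : Fin N), cbar) with htc
  set tf : GridPoint Lf N := ((0 : Fin N), w.2) with htf
  set xg : GridPoint Lc N → TorusSite 2 Lc := fun q => (q - tc).2 with hxg
  set τg : GridPoint Lc N → ℝ := fun q => gridTime β N (q - tc).1 with hτg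
  set xg' : GridPoint Lf N → TorusSite 2 Lf := fun q => (q - tf).2 with hxg'
  set τg' : GridPoint Lf N → ℝ := fun q => gridTime β N (q - tf).1 with hτg'
  set o : GridPoint Lc N := (w.1, cbar) with ho
  set ι : GridPoint Lc N → GridPoint Lf N := fun q => (q.1, w.2 + Torus.proj Lf (Torus.cRep (q.2 - cbar))) with hι
  set uc : (Fin 2 → ℝ) → ℂ := fun q =>
    uvSymbolFn 1 (klScale klE0 n) (-2 * (∑ l : Fin 2, Real.cos (q l)) - μ - Kc.eval q) (matsubaraFreq β M i) with huc_def
  set uf : (Fin 2 → ℝ) → ℂ := fun q =>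
    uvSymbolFn 1 (klScale klE0 n) (-2 * (∑ l : Fin 2, Real.cos (q l)) - μ - Kf.eval q) (matsubaraFreq β M i) with huf_def
  set pc : FreqMomentum Lc M × Fin 2 → ℂ := fun ks => uvSymbolCT Lc M β μ Kc (klScale klE0 n) ks /
    (1 + uvSymbolCT Lc M β μ Kc (klScale klE0 n) ks * ((Kc.eval (latticeMomentum Lc ks.1.2) / (β * (Lc : ℝ) ^ 2) : ℝ) : ℂ)) with hpc
  set pf : FreqMomentum Lf M × Fin 2 → ℂ := fun ks => uvSymbolCT Lf M β μ Kf (klScale klE0 n) ks /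
    (1 + uvSymbolCT Lf M β μ Kf (klScale klE0 n) ks * ((Kf.eval (latticeMomentum Lf ks.1.2) / (β * (Lf : ℝ) ^ 2) : ℝ) : ℂ)) with hpf
  set Wc := effAction ℂ ((hubbardGridSub Lc M β N).transpose * normalCovariance Lc M pc * hubbardGridSub Lc M β N) (hubbardGridInteraction Lc N β U)
    with hWc
  set Wf := effAction ℂ ((hubbardGridSub Lf M β N).transpose * normalCovariance Lf M pf * hubbardGridSub Lf M β N) (hubbardGridInteraction Lf N β U)
    with hWf
  -- geometry
  have hxo : xg o = 0 := by simp [hxg, ho, htc]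
  have hιx : ∀ q, xg' (ι q) = Torus.proj Lf (Torus.cRep (xg q)) := by
    intro q; simp [hxg', hι, htf, hxg, htc]
  have hιτ : ∀ q, τg' (ι q) = τg q := by intro q; simp [hτg', hι, htf, hτg, htc]
  have hιinj : Function.Injective ι := blockEmb_injective (N := N) hL w.2 cbar
  have hblock : ∀ p' : GridPoint Lf N, Torus.proj Lf (Torus.cRep (fun i => (((xg' p' i).val : ℕ) : ZMod Lc))) = xg' p' → p' ∈ Set.range ι := by
    intro p' hp'
    have hx : xg' p' = p'.2 - w.2 := by simp [hxg', htf]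
    rw [hx] at hp'
    exact mem_range_blockEmb w.2 cbar p' hp'
  have hPc : Fintype.card (GridPoint Lc N) = N * Lc ^ 2 := card_gridPoint Lc
  have hPf : Fintype.card (GridPoint Lf N) = N * Lf ^ 2 := card_gridPoint Lf
  -- representations
  have hrepc : ExteriorAlgebra.map (Matrix.toLin' (gridSubMatrix Lc M β xg τg)) Wc = effAction ℂ (normalCovariance Lc M pc) (hubbardInteraction Lc M β U) :=
    map_gridSubMatrix_shift_gridEffAction hβ.ne' hN hN4 pc U cbar
  have hrepf : ExteriorAlgebra.map (Matrix.toLin' (gridSubMatrix Lf M β xg' τg')) Wf = effAction ℂ (normalCovariance Lf M pf) (hubbardInteraction Lf M β U) :=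
    map_gridSubMatrix_shift_gridEffAction hβ.ne' hN hN4 pf U w.2
  -- rows
  have hrowc := fun (p₀ : GridPoint Lc N) (y : TorusSite 2 Lc) => gridEffAction_row_eq_row_shift hβ.ne' hN pc U cbar i σ p₀ o y
  have hrowf := fun (p₀' : GridPoint Lf N) (y : TorusSite 2 Lf) => gridEffAction_row_eq_row_shift hβ.ne' hN pf U w.2 i σ p₀' (ι o) y
  -- the symbols
  have huc : ∀ kv : TorusSite 2 Lc, uvSymbolCT Lc M β μ Kc (klScale klE0 n) ((i, kv), σ) = ((β * (Lc : ℝ) ^ 2 : ℝ) : ℂ) * uc (latticeMomentum Lc kv) :=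
    fun kv => uvSymbolCT_eq_mul_sampled hβ μ Kc (klScale klE0 n) i kv σ
  have huf : ∀ kv : TorusSite 2 Lf, uvSymbolCT Lf M β μ Kf (klScale klE0 n) ((i, kv), σ) = ((β * (Lf : ℝ) ^ 2 : ℝ) : ℂ) * uf (latticeMomentum Lf kv) :=
    fun kv => uvSymbolCT_eq_mul_sampled hβ μ Kf (klScale klE0 n) i kv σ
  -- the pin coincides with `ι o`
  have hιo : ι o = w := by
    simp only [hι, ho, sub_self]
    ext1
    · rfl
    · show w.2 + Torus.proj Lf (Torus.cRep (0 : TorusSite 2 Lc)) = w.2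
      rw [clift_zero, add_zero]
  have key := norm_klSelfEnergy_sub_le_resummed_of_latticeMomentum_eq hL hβ U μ Kc Kf n xg τg xg' τg' hPc hPf ι hιinj hιx hιτ hblock hxo i σ
    uc uf huc huf Wc Wf hrepc hrepf hZc hZf hrowc hrowf hk
  rw [hιo] at key
  exact key

end Door

end Summit.HubbardSuperconductivity.HubbardSuperconductivity.Theorems.TwoVolumeDefect
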